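import Mathlib

/-! # Addition gadget for integral border Q-words: stub `stub_ibqAdd` of line `Sketch` (eps-order-ladder) for crux `WordLengthQP` (stmt-ValiantsHypothesis-6623)

We prove the integral form of the ADDITION gadget of Bringmann–Ikenmeyer–Zuiddam
(J. ACM 65 (2018) art. 32 = CCC 2017, arXiv:1702.05328, §3, Lemma 3.2) for border width-2
programs made of affine Q-letters.  A letter `((c, o), m) : (Polynomial ℂ × Option σ) × ℕ` stands
for the `2 × 2` matrix `[[C c * (o.elim 1 X), C (ε ^ m)], [C (ε ^ m), 0]]` over
`R = MvPolynomial σ (Polynomial ℂ)` (`ε = Polynomial.X`), and `Q(f) = [[f, 1], [1, 0]]` with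
`f : MvPolynomial σ ℂ` embedded into `R` by `MvPolynomial.map Polynomial.C`.

**Statement** (`stub_ibqAdd`): if a product of at most `L₁` letters equals
`C (ε ^ M₁) • Q(f) + C (ε ^ (M₁ + κ)) • G₁` with `M₁ ≤ μ₁`, and a product of at most `L₂` letters
equals `C (ε ^ M₂) • Q(g) + C (ε ^ (M₂ + κ)) • G₂` with `M₂ ≤ μ₂`, then some product of at most
`L₁ + L₂ + 1` letters equals `C (ε ^ M) • Q(f + g) + C (ε ^ (M + κ)) • G` with `M ≤ μ₁ + μ₂`.

**Proof**: concatenate the two words around the joint letter `((0, none), 0) = Q(0) = [[0,1],[1,0]]`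
and use `Q(f) · Q(0) · Q(g) = Q(f + g)`; then `M = M₁ + M₂` and
`G = Q(f) Q(0) G₂ + G₁ Q(0) Q(g) + C (ε ^ κ) • G₁ Q(0) G₂` (the `2 × 2` identity `ibqAdd_key`).
Mathlib only. -/

-- `Summit.ValiantsHypothesis.ValiantsHypothesis.…` is the tree's mandated single-conjunct layout (Sub = Summit).
set_option linter.dupNamespace false

noncomputable section

open MvPolynomial

namespace Summit.ValiantsHypothesis.ValiantsHypothesis.Cruxes.WordLengthQP.EpsOrderLadder

/-- The `2 × 2` matrix identity behind the addition gadget (BIZ18 Lemma 3.2), over any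
commutative ring: `(e^M₁ Q(F) + e^(M₁+κ) G₁) · Q(0) · (e^M₂ Q(F') + e^(M₂+κ) G₂)
  = e^(M₁+M₂) Q(F+F') + e^(M₁+M₂+κ) (Q(F) Q(0) G₂ + G₁ Q(0) Q(F') + e^κ G₁ Q(0) G₂)`,
where `Q(F) = !![F, 1; 1, 0]`. -/
theorem ibqAdd_key {R : Type*} [CommRing R] (e F F' : R) (M₁ M₂ κ : ℕ)
    (G₁ G₂ : Matrix (Fin 2) (Fin 2) R) :
    (e ^ M₁ • (!![F, 1; 1, 0] : Matrix (Fin 2) (Fin 2) R) + e ^ (M₁ + κ) • G₁) *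
        ((!![0, 1; 1, 0] : Matrix (Fin 2) (Fin 2) R) *
          (e ^ M₂ • (!![F', 1; 1, 0] : Matrix (Fin 2) (Fin 2) R) + e ^ (M₂ + κ) • G₂))
      = e ^ (M₁ + M₂) • (!![F + F', 1; 1, 0] : Matrix (Fin 2) (Fin 2) R)
        + e ^ (M₁ + M₂ + κ) •
          ((!![F, 1; 1, 0] : Matrix (Fin 2) (Fin 2) R) *
              ((!![0, 1; 1, 0] : Matrix (Fin 2) (Fin 2) R) * G₂)
            + G₁ * ((!![0, 1; 1, 0] : Matrix (Fin 2) (Fin 2) R) *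
              (!![F', 1; 1, 0] : Matrix (Fin 2) (Fin 2) R))
            + e ^ κ • (G₁ * ((!![0, 1; 1, 0] : Matrix (Fin 2) (Fin 2) R) * G₂))) := by
  ext i j
  fin_cases i <;> fin_cases j <;> simp [Matrix.mul_apply, -Matrix.cons_mul] <;> ring

/-- **stub_ibqAdd** (BIZ18 Lemma 3.2, integral form): `P_F · Q(0) · P_G` — if
`P_F = ε^M₁ Q(f) + ε^(M₁+κ) G₁` and `P_G = ε^M₂ Q(g) + ε^(M₂+κ) G₂` then the product is
`ε^(M₁+M₂) Q(f+g) + ε^(M₁+M₂+κ) G`, since `Q(f) Q(0) Q(g) = Q(f+g)`; `Q(0)` is the letter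
`((0, none), 0)`, so the new word has length `≤ L₁ + L₂ + 1` and shift `M₁ + M₂ ≤ μ₁ + μ₂`. -/
theorem stub_ibqAdd :
    ∀ {σ : Type} (f g : MvPolynomial σ ℂ) (μ₁ μ₂ κ L₁ L₂ : ℕ),
      (∃ w : List ((Polynomial ℂ × Option σ) × ℕ), w.length ≤ L₁ ∧ ∃ M : ℕ, M ≤ μ₁ ∧
        ∃ G : Matrix (Fin 2) (Fin 2) (MvPolynomial σ (Polynomial ℂ)),
          (w.map (fun l => (!![MvPolynomial.C l.1.1 * l.1.2.elim 1 MvPolynomial.X,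
              MvPolynomial.C (Polynomial.X ^ l.2); MvPolynomial.C (Polynomial.X ^ l.2), 0] :
                Matrix (Fin 2) (Fin 2) (MvPolynomial σ (Polynomial ℂ))))).prod
            = (MvPolynomial.C (Polynomial.X ^ M) : MvPolynomial σ (Polynomial ℂ)) •
                (!![MvPolynomial.map Polynomial.C f, 1; 1, 0] :
                  Matrix (Fin 2) (Fin 2) (MvPolynomial σ (Polynomial ℂ)))
              + (MvPolynomial.C (Polynomial.X ^ (M + κ)) : MvPolynomial σ (Polynomial ℂ)) • G) →
      (∃ w : List ((Polynomial ℂ × Option σ) × ℕ), w.length ≤ L₂ ∧ ∃ M : ℕ, M ≤ μ₂ ∧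
        ∃ G : Matrix (Fin 2) (Fin 2) (MvPolynomial σ (Polynomial ℂ)),
          (w.map (fun l => (!![MvPolynomial.C l.1.1 * l.1.2.elim 1 MvPolynomial.X,
              MvPolynomial.C (Polynomial.X ^ l.2); MvPolynomial.C (Polynomial.X ^ l.2), 0] :
                Matrix (Fin 2) (Fin 2) (MvPolynomial σ (Polynomial ℂ))))).prod
            = (MvPolynomial.C (Polynomial.X ^ M) : MvPolynomial σ (Polynomial ℂ)) •
                (!![MvPolynomial.map Polynomial.C g, 1; 1, 0] :
                  Matrix (Fin 2) (Fin 2) (MvPolynomial σ (Polynomial ℂ)))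
              + (MvPolynomial.C (Polynomial.X ^ (M + κ)) : MvPolynomial σ (Polynomial ℂ)) • G) →
      (∃ w : List ((Polynomial ℂ × Option σ) × ℕ), w.length ≤ L₁ + L₂ + 1 ∧ ∃ M : ℕ, M ≤ μ₁ + μ₂ ∧
        ∃ G : Matrix (Fin 2) (Fin 2) (MvPolynomial σ (Polynomial ℂ)),
          (w.map (fun l => (!![MvPolynomial.C l.1.1 * l.1.2.elim 1 MvPolynomial.X,
              MvPolynomial.C (Polynomial.X ^ l.2); MvPolynomial.C (Polynomial.X ^ l.2), 0] :
                Matrix (Fin 2) (Fin 2) (MvPolynomial σ (Polynomial ℂ))))).prod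
            = (MvPolynomial.C (Polynomial.X ^ M) : MvPolynomial σ (Polynomial ℂ)) •
                (!![MvPolynomial.map Polynomial.C (f + g), 1; 1, 0] :
                  Matrix (Fin 2) (Fin 2) (MvPolynomial σ (Polynomial ℂ)))
              + (MvPolynomial.C (Polynomial.X ^ (M + κ)) : MvPolynomial σ (Polynomial ℂ)) • G) := by
  intro σ f g μ₁ μ₂ κ L₁ L₂ hf hg
  obtain ⟨w₁, hw₁, M₁, hM₁, G₁, h₁⟩ := hf
  obtain ⟨w₂, hw₂, M₂, hM₂, G₂, h₂⟩ := hg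
  refine ⟨w₁ ++ ((0, none), 0) :: w₂, ?_, M₁ + M₂, Nat.add_le_add hM₁ hM₂,
    (!![MvPolynomial.map Polynomial.C f, 1; 1, 0] :
          Matrix (Fin 2) (Fin 2) (MvPolynomial σ (Polynomial ℂ))) *
        ((!![0, 1; 1, 0] : Matrix (Fin 2) (Fin 2) (MvPolynomial σ (Polynomial ℂ))) * G₂)
      + G₁ * ((!![0, 1; 1, 0] : Matrix (Fin 2) (Fin 2) (MvPolynomial σ (Polynomial ℂ))) *
        (!![MvPolynomial.map Polynomial.C g, 1; 1, 0] :
          Matrix (Fin 2) (Fin 2) (MvPolynomial σ (Polynomial ℂ))))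
      + (MvPolynomial.C Polynomial.X : MvPolynomial σ (Polynomial ℂ)) ^ κ •
        (G₁ * ((!![0, 1; 1, 0] : Matrix (Fin 2) (Fin 2) (MvPolynomial σ (Polynomial ℂ))) * G₂)),
    ?_⟩
  · simp only [List.length_append, List.length_cons]
    omega
  · rw [List.map_append, List.map_cons, List.prod_append, List.prod_cons, h₁, h₂]
    simp only [map_zero, zero_mul, pow_zero, map_one, map_pow, map_add]
    exact ibqAdd_key (MvPolynomial.C Polynomial.X : MvPolynomial σ (Polynomial ℂ))
      (MvPolynomial.map Polynomial.C f) (MvPolynomial.map Polynomial.C g) M₁ M₂ κ G₁ G₂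

end Summit.ValiantsHypothesis.ValiantsHypothesis.Cruxes.WordLengthQP.EpsOrderLadder
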